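import Summits.FinalStateConjecture.FinalStateConjecture.Theses.TangentConeAtIPlus
import Literature.Geometry.Lorentzian.TameGenericityDiagonal
import HarnessLib

/-!
# Birth skeleton (BC3) — crux stmt-FinalStateConjecture-17668 `Theses.TangentConeAtIPlus.FiniteKerrParticleCone` (rank 2)
# line `birth` (skeleton registrar planner-skel-stmt-FinalStateConjecture-17668-0, 2026-08-17; BC3 of run/shared/lean/lens3/_common/BC.md)

Target, BY NAME: `Summit.FinalStateConjecture.FinalStateConjecture.Theses.TangentConeAtIPlus.FiniteKerrParticleCone` (route file rev 4), concluded by `FiniteKerrParticleCone_of` from three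
named stubs. The crux says: for every admissible `3`-manifold `Σ`, TAME-Christodoulou-generically
in `admissibleVacuumData Σ`, the datum has an MGHD and EVERY MGHD carries CONE DATA at `i⁺` (the
route's `let Cone := …` predicate: finitely many straight world-lines `(Λᵢ, cᵢ)` with orthochronous
`Λᵢ`, continuous SUBLINEAR drifts `dᵢ` and radii `σᵢ → ∞`, pairwise disjoint drifted tubes, one
flat late chart `Φ` on `U ⊇ {y⁰ > T} ∖ ⋃ tubes` into `J⁺(ιΣ)`, future-oriented, SCALE-INVARIANTLY
`C²`-flat in the timelike interior off the STRAIGHT rays and plain-`C²`-flat on its full slabs, plus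
the basin clause: each `i` recurrently `ε`-close to ONE sub-extremal boosted Kerr `(Mᵢ, aᵢ, Λᵢ)`).

## The cut = the route header's own TWO-LAYER PLAN for this crux, typed
## ("FiniteKerrParticleCone ⇐ IslandsLemma → IslandKinematics", GMT dictionary: concentration set
## first, uniqueness of the tangent cone second), with the anti-vacuity conjunct isolated

* `stub_mghdExists` — **MGHD existence for admissible data** (Choquet-Bruhat–Geroch 1969, Thm 3;
  Sbierski 2016): every `D ∈ admissibleVacuumData X` has a maximal vacuum Cauchy development.
  Verbatim the shape of the sibling items `MGHDExists` / `MaximalDevelopmentExists` /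
  `AdmissibleMGHDExists` of the other routes of this summit and of the conclusion of
  `Literature.Geometry.Lorentzian.choquetBruhat_geroch_exists_mghd_cauchy.forall_mem_admissibleVacuumData`
  (closable by `exact h.forall_mem_admissibleVacuumData` from the named fact; in print, not in tree).
  It is the crux's anti-vacuity conjunct `∃ 𝒟, 𝒟.IsMaximal`, isolated so that the generic stub is
  purely a late-time statement.
* `stub_islands` — **THE ISLANDS LEMMA** (TAME-GENERIC; the load-bearing stub; the card's K0 =
  "dynamical Lichnerowicz" + the ω-limit / basin content): tame-generically in the admissible class,
  EVERY MGHD carries ISLAND DATA `(N, (Λᵢ, cᵢ), σᵢ, dᵢ, T, U, Φ)` — the predicate `Island` below,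
  which is the route's `Cone` predicate with exactly two clauses WEAKENED: (i) the drift `dᵢ` is an
  ARBITRARY continuous curve (only the radius is sublinear, `σᵢ(s)/s → 0`; the tube centre
  `s ↦ Lᵢ(s) + dᵢ(s)` is any continuous world-line, so NO asymptotic velocity is asserted — `Λᵢ` is
  merely the orthochronous frame in which the tube is sliced and in which the basin recurrence
  happens), and (ii) the scale-invariant weighted `C²`-flatness of `Φ^*g − η` in the timelike
  interior `{x⁰ = τ, |x̲| ≤ (1−δ)τ}` is demanded OFF THE `δτ`-FATTENED DRIFTED TUBES `⋃ᵢ tubeᵢ(δτ)`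
  (the actual, possibly curved concentration set), not off the straight rays `{dᵢ(x) ≥ δτ}`.
  Everything else is verbatim: orthochronous frames, continuity, `σᵢ → ∞`, pairwise disjoint
  `tubeᵢ(5)`, `U ⊇ {y⁰ > T} ∖ ⋃ᵢ tubeᵢ(0)`, `IsLateChart` into `J⁺(ιΣ)`, `Φ_*∂₀` future-directed,
  plain `C²` wave-zone flatness on full slabs, and the basin clause (one sub-extremal `(Mᵢ, aᵢ)` per
  island, recurrent `ε`-closeness of a Kerr window chart glued to `Φ ∘ (x ↦ x + dᵢ(tᵢ x))` on the
  annulus). In blow-down language: the scale-invariant strong-field set of the development is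
  confined to finitely many receding world-tubes of sublinear radius, each recurrently near ONE
  sub-extremal Kerr, with a weak-field chart outside — the route header's IslandsLemma, verbatim
  in intent. Open problem (the generic large-data heart of the conjecture: trapped-surface
  formation vs dispersion, merger finiteness, no late cascade of small holes, ω-limit rigidity /
  no-hair, generic sub-extremality).
* `stub_coneKinematics` — **ISLAND KINEMATICS = UNIQUENESS OF THE TANGENT CONE AT `i⁺`**
  (DETERMINISTIC, `∀` admissible datum, `∀` MGHD): island data ⇒ cone data. Content: (a) every
  island has an ASYMPTOTIC VELOCITY — its world-line is `Λᵢ`-straight up to a sublinear drift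
  (finite tidal impulse between mutually receding islands; the general-relativistic analogue of
  Chazy 1922 (doi:10.24033/asens.739) / Marchal–Saari 1976 (doi:10.1016/0022-0396(76)90101-7)
  "`qᵢ = Aᵢ t + O(t^(2/3))` or superhyperbolic" for the Newtonian `N`-body problem, superhyperbolic
  escape being excluded here by `|v| < 1`), and that velocity is
  the basin frame's (recurrent `C²`-closeness to `Λᵢ`-boosted Kerr glued to the flat chart pins the
  recurrent velocity); (b) bookkeeping: with sublinear drift, `{dᵢ ≥ δτ}` avoids `tubeᵢ(δ'τ)` for
  late `τ` and `δ' < δ`, so interior flatness off the fattened tubes gives the cone's flatness off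
  the straight rays; radii, `T`, `U`, `Φ` are re-chosen. This is the card's "cone uniqueness
  (asymptotic velocities, finite impulse) playing the role of Allard–Almgren / Simon uniqueness of
  tangent cones". Open as stated (no equations-of-motion theorem for strong-field bodies in GR
  gives (a)); believed true for every datum admitting island data.

`FiniteKerrParticleCone_of : Sig.stub_mghdExists → Sig.stub_islands → Sig.stub_coneKinematics → <crux>`
(sorry-free, below; `Sig.stub_*` = the stub statements verbatim as named `Prop`s, see the Legend): tame
Christodoulou genericity is monotone under
pointwise implication on the admissible class (`InitialDataSet.IsTameChristodoulouGeneric.mono`,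
`Literature/Geometry/Lorentzian/TameGenericityDiagonal.lean`, landed): from `stub_islands`, at an
admissible datum with island data on every MGHD, `stub_mghdExists` supplies the MGHD conjunct and
`stub_coneKinematics` turns island data into cone data MGHD by MGHD. The `let`-bound `Cone` of
`stub_coneKinematics` is textually the route decl's, so the conclusion is the crux definitionally.

## Why this is not shredding / costume

`stub_islands` is STRICTLY WEAKER in content than the crux (cone data are island data up to the
bookkeeping (b) — not syntactically: the two weakened clauses are not sub-conjuncts), and what it
drops is a named theorem-sized piece with its own classical literature (existence of asymptotic
velocities), carried by `stub_coneKinematics`, which in turn asserts nothing generic and nothing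
about existence of islands. Neither stub implies the crux or the summit cheaply (BC3 probes, all
FAIL: see `Lines/birth.md`), and the crux implies neither stub syntactically. `stub_mghdExists` is
the standard anti-vacuity conjunct of this summit (a sibling item on four routes), not a slice of
the difficulty.

Disproof used: no `Cruxes/FiniteKerrParticleCone/Disproof.lean` exists at registration
(`ledger crux ls stmt-FinalStateConjecture-17668`: no workfiles); no `_false_without_` obligations.
Negatives index (`ledger negatives --problem FinalStateConjecture`, 2026-08-17): 1 entry,
`not_UniformPhotonSphereChannels` (an ODE channel estimate) — unrelated to every stub.
-/

set_option linter.dupNamespace false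

noncomputable section

namespace Summit.FinalStateConjecture.FinalStateConjecture.Cruxes.FiniteKerrParticleCone.Birth

open scoped BigOperators Topology Manifold Classical MeasureTheory ProbabilityTheory Matrix InnerProductSpace ComplexConjugate ContinuousMap
open Filter Set Function TopologicalSpace MeasureTheory
open Literature.Geometry.Lorentzian

/-! ## Legend: the three stub statements as named propositions (verbatim the registered signatures)

The skeleton audit (`#h21_check_skeleton`, HarnessLib.Audit.Check) admits a `Prop` hypothesis of the composition
theorem only BY NAME (head constant = a registered obligation or a declared stub); the `Sig.stub_*` defs give the
verbatim stub statements such a head (last name component = the stub's name), exactly as in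
`Cruxes/SettlesOutsidePhotonRegions/Lines/birth.lean`. The final `example` kernel-checks that each `Sig.stub_*`
is the statement of `stub_*`. -/

/-- Statement of `stub_mghdExists` (verbatim): every admissible datum has a maximal vacuum Cauchy development
(Choquet-Bruhat–Geroch 1969, Thm 3). -/
def Sig.stub_mghdExists : Prop :=
  open Literature.Geometry.Lorentzian in open scoped ContDiff in ∀ (X : Type) [TopologicalSpace X] [ChartedSpace E3 X] [IsManifold (𝓡 3) ∞ X] [T2Space X] [SecondCountableTopology X] [ConnectedSpace X], ∀ D ∈ admissibleVacuumData X, ∃ 𝒟 : VacuumCauchyDevelopment D, 𝒟.IsMaximal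

/-- Statement of `stub_islands` (verbatim): tame-generically, every MGHD carries island data (`Island`: curved
continuous world-tubes of sublinear radius, pairwise disjoint, a future-oriented flat late chart outside which is
scale-invariantly `C²`-flat off the fattened tubes and plain-`C²`-flat on full slabs, and recurrent `ε`-closeness
of each island to ONE sub-extremal boosted Kerr). -/
def Sig.stub_islands : Prop :=
  open Literature.Geometry.Lorentzian in open scoped ContDiff in let Island := fun (𝓢 : Spacetime.{0} 4) (S : Set 𝓢.carrier) (N : ℕ) (mo : Fin N → lorentzGroup × E4) (σ : Fin N → ℝ → ℝ) (dr : Fin N → ℝ → E4) (T : ℝ) (U : Opens E4) (Φ : U → 𝓢.carrier) => let t := fun i (x : E4) => poincareInv (mo i).1 (mo i).2 x 0; let d := fun i (x : E4) => E4.spatialNorm (poincareInv (mo i).1 (mo i).2 x); let tube := fun i (w : ℝ) => (fun x ↦ x + dr i (t i x)) '' {x : E4 | d i x ≤ σ i (t i x) + w} ∩ {y | T < y 0}; let F := Minkowski.backgroundOn U; (∀ i, Summit.FinalStateConjecture.IsOrthochronous (mo i).1 ∧ Continuous (σ i) ∧ Continuous (dr i) ∧ Tendsto (fun s : ℝ ↦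 σ i s / s) atTop (𝓝 0) ∧ Tendsto (σ i) atTop atTop) ∧ (∀ i j, i ≠ j → Disjoint (tube i 5) (tube j 5)) ∧ {y : E4 | T < y 0} \ (⋃ i, tube i 0) ⊆ (U : Set E4) ∧ 𝓢.IsLateChart F (𝓢.metric.causalFuture 𝓢.timeOrientation S) T Φ ∧ (∀ x : U, 𝓢.timeOrientation.IsFutureDirected (mfderiv 𝓘(ℝ, E4) (𝓡 4) Φ x (EuclideanSpace.single 0 1))) ∧ (∀ δ : ℝ, 0 < δ → Tendsto (fun τ : ℝ ↦ weightedCkSeminorm ({x : E4 | x 0 = τ ∧ E4.spatialNorm x ≤ (1 - δ) * τ} \ ⋃ i, tube i (δ * τ)) 2 0 (𝓢.deviationExtend F Φ)) atTop (𝓝 0)) ∧ Tendsto (fun τ : ℝ ↦ 𝓢.deviationCk F Φ 2 τ) atTop (𝓝 0) ∧ (∀ i, ∃ M a : ℝ, Kerr.IsSubextremal M a ∧ ∀ ε : ENNReal, 0 < ε → ∀ τ₁ : ℝ, ∃ τ : ℝ, τ₁ ≤ τ ∧ (let B := boostedKerrBackground (mo i).1 (mo i).2 M a; ∃ Ψ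 : B.domain → 𝓢.carrier, ContMDiff 𝓘(ℝ, E4) (𝓡 4) ∞ Ψ ∧ Topology.IsOpenEmbedding ({x : B.domain | |t i x.1 - τ| < 1 ∧ d i x.1 < σ i (t i x.1) + |a| + 6}.restrict Ψ) ∧ (∀ x : B.domain, |t i x.1 - τ| < 1 → σ i (t i x.1) + 1 ≤ d i x.1 → d i x.1 < σ i (t i x.1) + 4 → ∃ hx : x.1 + dr i (t i x.1) ∈ (U : Set E4), Ψ x = Φ ⟨_, hx⟩) ∧ 𝓢.truncDeviationCk B Ψ 2 (σ i τ + 5) τ ≤ ε)); ∀ (X : Type) [TopologicalSpace X] [ChartedSpace E3 X] [IsManifold (𝓡 3) ∞ X] [T2Space X] [SecondCountableTopology X] [ConnectedSpace X], InitialDataSet.IsTameChristodoulouGeneric (admissibleVacuumData X) (fun D ↦ ∀ 𝒟 : VacuumCauchyDevelopment D, 𝒟.IsMaximal → ∃ (N : ℕ) (mo : Fin N → lorentzGroup × E4) (σ : Fin N → ℝ → ℝ) (dr : Fin N → ℝ → E4) (T : ℝ) (U : Opens E4) (Φ : U → 𝒟.carrier), Island 𝒟.toSpacetime (range 𝒟.embed)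 N mo σ dr T U Φ) 1

/-- Statement of `stub_coneKinematics` (verbatim): for every admissible datum and every MGHD, island data give
cone data (asymptotic velocities + sublinear drifts; flatness off the straight rays). -/
def Sig.stub_coneKinematics : Prop :=
  open Literature.Geometry.Lorentzian in open scoped ContDiff in let Island := fun (𝓢 : Spacetime.{0} 4) (S : Set 𝓢.carrier) (N : ℕ) (mo : Fin N → lorentzGroup × E4) (σ : Fin N → ℝ → ℝ) (dr : Fin N → ℝ → E4) (T : ℝ) (U : Opens E4) (Φ : U → 𝓢.carrier) => let t := fun i (x : E4) => poincareInv (mo i).1 (mo i).2 x 0; let d := fun i (x : E4) => E4.spatialNorm (poincareInv (mo i).1 (mo i).2 x); let tube := fun i (w : ℝ) => (fun x ↦ x + dr i (t i x)) '' {x : E4 | d i x ≤ σ i (t i x) + w} ∩ {y | T < y 0}; let F := Minkowski.backgroundOn U; (∀ i, Summit.FinalStateConjecture.IsOrthochronous (mo i).1 ∧ Continuous (σ i) ∧ Continuous (dr i) ∧ Tendsto (fun s : ℝ ↦ σ i s / s) atTop (𝓝 0) ∧ Tendsto (σ i) atTop atTop) ∧ (∀ i j, i ≠ j → Disjoint (tube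 i 5) (tube j 5)) ∧ {y : E4 | T < y 0} \ (⋃ i, tube i 0) ⊆ (U : Set E4) ∧ 𝓢.IsLateChart F (𝓢.metric.causalFuture 𝓢.timeOrientation S) T Φ ∧ (∀ x : U, 𝓢.timeOrientation.IsFutureDirected (mfderiv 𝓘(ℝ, E4) (𝓡 4) Φ x (EuclideanSpace.single 0 1))) ∧ (∀ δ : ℝ, 0 < δ → Tendsto (fun τ : ℝ ↦ weightedCkSeminorm ({x : E4 | x 0 = τ ∧ E4.spatialNorm x ≤ (1 - δ) * τ} \ ⋃ i, tube i (δ * τ)) 2 0 (𝓢.deviationExtend F Φ)) atTop (𝓝 0)) ∧ Tendsto (fun τ : ℝ ↦ 𝓢.deviationCk F Φ 2 τ) atTop (𝓝 0) ∧ (∀ i, ∃ M a : ℝ, Kerr.IsSubextremal M a ∧ ∀ ε : ENNReal, 0 < ε → ∀ τ₁ : ℝ, ∃ τ : ℝ, τ₁ ≤ τ ∧ (let B := boostedKerrBackground (mo i).1 (mo i).2 M a; ∃ Ψ : B.domain → 𝓢.carrier, ContMDiff 𝓘(ℝ, E4) (𝓡 4) ∞ Ψ ∧ Topology.IsOpenEmbedding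 ({x : B.domain | |t i x.1 - τ| < 1 ∧ d i x.1 < σ i (t i x.1) + |a| + 6}.restrict Ψ) ∧ (∀ x : B.domain, |t i x.1 - τ| < 1 → σ i (t i x.1) + 1 ≤ d i x.1 → d i x.1 < σ i (t i x.1) + 4 → ∃ hx : x.1 + dr i (t i x.1) ∈ (U : Set E4), Ψ x = Φ ⟨_, hx⟩) ∧ 𝓢.truncDeviationCk B Ψ 2 (σ i τ + 5) τ ≤ ε)); let Cone := fun (𝓢 : Spacetime.{0} 4) (S : Set 𝓢.carrier) (N : ℕ) (mo : Fin N → lorentzGroup × E4) (σ : Fin N → ℝ → ℝ) (dr : Fin N → ℝ → E4) (T : ℝ) (U : Opens E4) (Φ : U → 𝓢.carrier) => let t := fun i (x : E4) => poincareInv (mo i).1 (mo i).2 x 0; let d := fun i (x : E4) => E4.spatialNorm (poincareInv (mo i).1 (mo i).2 x); let tube := fun i (w : ℝ) => (fun x ↦ x + dr i (t i x)) '' {x : E4 | d i x ≤ σ i (t i x) + w} ∩ {y | T < y 0}; let F := Minkowski.backgroundOn U; (∀ i, Summit.FinalStateConjecture.IsOrthochronous (mo i).1 ∧ Continuous (σ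 i) ∧ Continuous (dr i) ∧ Tendsto (fun s : ℝ ↦ (|σ i s| + ‖dr i s‖) / s) atTop (𝓝 0) ∧ Tendsto (σ i) atTop atTop) ∧ (∀ i j, i ≠ j → Disjoint (tube i 5) (tube j 5)) ∧ {y : E4 | T < y 0} \ (⋃ i, tube i 0) ⊆ (U : Set E4) ∧ 𝓢.IsLateChart F (𝓢.metric.causalFuture 𝓢.timeOrientation S) T Φ ∧ (∀ x : U, 𝓢.timeOrientation.IsFutureDirected (mfderiv 𝓘(ℝ, E4) (𝓡 4) Φ x (EuclideanSpace.single 0 1))) ∧ (∀ δ : ℝ, 0 < δ → Tendsto (fun τ : ℝ ↦ weightedCkSeminorm {x : E4 | x 0 = τ ∧ E4.spatialNorm x ≤ (1 - δ) * τ ∧ ∀ i, δ * τ ≤ d i x} 2 0 (𝓢.deviationExtend F Φ)) atTop (𝓝 0)) ∧ Tendsto (fun τ : ℝ ↦ 𝓢.deviationCk F Φ 2 τ) atTop (𝓝 0) ∧ (∀ i, ∃ M a : ℝ, Kerr.IsSubextremal M a ∧ ∀ ε : ENNReal, 0 < ε → ∀ τ₁ : ℝ, ∃ τ : ℝ, τ₁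 ≤ τ ∧ (let B := boostedKerrBackground (mo i).1 (mo i).2 M a; ∃ Ψ : B.domain → 𝓢.carrier, ContMDiff 𝓘(ℝ, E4) (𝓡 4) ∞ Ψ ∧ Topology.IsOpenEmbedding ({x : B.domain | |t i x.1 - τ| < 1 ∧ d i x.1 < σ i (t i x.1) + |a| + 6}.restrict Ψ) ∧ (∀ x : B.domain, |t i x.1 - τ| < 1 → σ i (t i x.1) + 1 ≤ d i x.1 → d i x.1 < σ i (t i x.1) + 4 → ∃ hx : x.1 + dr i (t i x.1) ∈ (U : Set E4), Ψ x = Φ ⟨_, hx⟩) ∧ 𝓢.truncDeviationCk B Ψ 2 (σ i τ + 5) τ ≤ ε)); ∀ (X : Type) [TopologicalSpace X] [ChartedSpace E3 X] [IsManifold (𝓡 3) ∞ X] [T2Space X] [SecondCountableTopology X] [ConnectedSpace X] (D : InitialDataSet (𝓡 3) X), D ∈ admissibleVacuumData X → ∀ 𝒟 : VacuumCauchyDevelopment D, 𝒟.IsMaximal → ∀ (N : ℕ) (mo : Fin N → lorentzGroup × E4) (σ : Fin N → ℝ → ℝ) (dr : Fin N → ℝ → E4) (T : ℝ) (U : Opens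 E4) (Φ : U → 𝒟.carrier), Island 𝒟.toSpacetime (range 𝒟.embed) N mo σ dr T U Φ → ∃ (N' : ℕ) (mo' : Fin N' → lorentzGroup × E4) (σ' : Fin N' → ℝ → ℝ) (dr' : Fin N' → ℝ → E4) (T' : ℝ) (U' : Opens E4) (Φ' : U' → 𝒟.carrier), Cone 𝒟.toSpacetime (range 𝒟.embed) N' mo' σ' dr' T' U' Φ'

/-! ## Registered stubs (`sorry` only here; signatures def-free and self-contained via `open … in let …`) -/

/-- **MGHD EXISTENCE FOR ADMISSIBLE DATA** (the crux's anti-vacuity conjunct, isolated). For every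
connected Hausdorff second-countable smooth `3`-manifold `X` and every `D ∈ admissibleVacuumData X`
there is a maximal vacuum Cauchy development of `D`. Choquet-Bruhat–Geroch, Comm. Math. Phys. 14
(1969) 329–335, Thm 3 (p. 332); Sbierski, Ann. Henri Poincaré 17 (2016) 301–329, Thm 2.8
(dezornified). In tree as the NAMED FACT `choquetBruhat_geroch_exists_mghd_cauchy`
(`Literature/Geometry/Lorentzian/CauchyProblemMGHDExistence.lean`) with this exact shape proved
from it (`….forall_mem_admissibleVacuumData`, `AdmissibleMGHDExistence.lean`); identical in statement
to the sibling items `BartnikGapSettling.MGHDExists`, `ConcentrationCannotWait.MaximalDevelopmentExists`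
(stmt-9981), `ProbeNullTrace.AdmissibleMGHDExists` (stmt-9937). Why it might fail: it does not (a
theorem in print); size: M as a formalisation (local existence + Zorn-free gluing), S given the fact. -/
theorem stub_mghdExists : open Literature.Geometry.Lorentzian in open scoped ContDiff in ∀ (X : Type) [TopologicalSpace X] [ChartedSpace E3 X] [IsManifold (𝓡 3) ∞ X] [T2Space X] [SecondCountableTopology X] [ConnectedSpace X], ∀ D ∈ admissibleVacuumData X, ∃ 𝒟 : VacuumCauchyDevelopment D, 𝒟.IsMaximal := by
  sorry

/-- **THE ISLANDS LEMMA** (tame-generic; load-bearing; the route header's `IslandsLemma`, card K0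
"dynamical Lichnerowicz" with the ω-limit content explicit). For every admissible `3`-manifold `X`,
the property "every MGHD `𝒟` of `D` admits ISLAND DATA `(N, (Λᵢ,cᵢ), σᵢ, dᵢ, T, U, Φ)`" is
tame-Christodoulou-generic with codimension `1` in `admissibleVacuumData X`, where island data are:
`Λᵢ` orthochronous; `σᵢ`, `dᵢ` continuous (the drift `dᵢ` an ARBITRARY continuous curve — no
asymptotic velocity), `σᵢ(s)/s → 0`, `σᵢ → ∞`; the drifted tubes `tubeᵢ(5)` pairwise disjoint;
`U ⊇ {y⁰ > T} ∖ ⋃ᵢ tubeᵢ(0)`; `Φ : U → M` a late chart into `J⁺(ιΣ)` with `Φ_*∂₀` future-directed;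
for every `δ > 0` the scale-invariant weighted `C²` seminorm of `Φ^*g − η` over
`{x⁰ = τ, |x̲| ≤ (1−δ)τ} ∖ ⋃ᵢ tubeᵢ(δτ)` tends to `0` (the blow-down is flat off the ACTUAL tubes);
the plain `C²` deviation on the full slab `{x⁰ = τ} ∩ U` tends to `0` (wave zone); and for each `i`
ONE sub-extremal `(Mᵢ, aᵢ)` such that for every `ε > 0`, at arbitrarily late rest times `τ`, a smooth
Kerr window chart `Ψ` from the `Λᵢ`-boosted Kerr exterior, an open embedding of
`{|tᵢ − τ| < 1, dᵢ < σᵢ(tᵢ) + |aᵢ| + 6}`, glued to `Φ ∘ (x ↦ x + dᵢ(tᵢ x))` on the annulus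
`σᵢ + 1 ≤ dᵢ < σᵢ + 4`, is `ε`-close in `C²` to boosted Kerr on `{t*ᵢ = τ, rᵢ ≤ σᵢ(τ) + 5}`.
Why it might fail: GENERIC (tame, one fixed end), all at once — finitely many islands (no late
cascade of small holes from generic data), sublinear confinement of the strong field, each island
recurrently `ε`-close to ONE sub-extremal Kerr (ω-limit rigidity / no-hair with no monotone
quantity; generic third law), a single weak-field chart outside reaching `J⁺(ιΣ)`. Sources:
DafermosLuk2017 (arXiv:1710.01722, §1.2.1), Christodoulou2008 (arXiv:0805.3880), AnLuk2017,
arXiv:2601.01517 (multi-black-hole data), IonescuKlainerman2012, AlexakisIonescuKlainerman2009,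
arXiv:2606.28253. Size: open problem. -/
theorem stub_islands : open Literature.Geometry.Lorentzian in open scoped ContDiff in let Island := fun (𝓢 : Spacetime.{0} 4) (S : Set 𝓢.carrier) (N : ℕ) (mo : Fin N → lorentzGroup × E4) (σ : Fin N → ℝ → ℝ) (dr : Fin N → ℝ → E4) (T : ℝ) (U : Opens E4) (Φ : U → 𝓢.carrier) => let t := fun i (x : E4) => poincareInv (mo i).1 (mo i).2 x 0; let d := fun i (x : E4) => E4.spatialNorm (poincareInv (mo i).1 (mo i).2 x); let tube := fun i (w : ℝ) => (fun x ↦ x + dr i (t i x)) '' {x : E4 | d i x ≤ σ i (t i x) + w} ∩ {y | T < y 0}; let F := Minkowski.backgroundOn U; (∀ i, Summit.FinalStateConjecture.IsOrthochronous (mo i).1 ∧ Continuous (σ i) ∧ Continuous (dr i) ∧ Tendsto (fun s : ℝ ↦ σ i s / s) atTop (𝓝 0) ∧ Tendsto (σ i) atTop atTop) ∧ (∀ i j, i ≠ j → Disjoint (tube i 5) (tube j 5)) ∧ {y : E4 | T < y 0} \ (⋃ i, tube i 0) ⊆ (U : Set E4) ∧ 𝓢.IsLateChart F (𝓢.metric.causalFuture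 𝓢.timeOrientation S) T Φ ∧ (∀ x : U, 𝓢.timeOrientation.IsFutureDirected (mfderiv 𝓘(ℝ, E4) (𝓡 4) Φ x (EuclideanSpace.single 0 1))) ∧ (∀ δ : ℝ, 0 < δ → Tendsto (fun τ : ℝ ↦ weightedCkSeminorm ({x : E4 | x 0 = τ ∧ E4.spatialNorm x ≤ (1 - δ) * τ} \ ⋃ i, tube i (δ * τ)) 2 0 (𝓢.deviationExtend F Φ)) atTop (𝓝 0)) ∧ Tendsto (fun τ : ℝ ↦ 𝓢.deviationCk F Φ 2 τ) atTop (𝓝 0) ∧ (∀ i, ∃ M a : ℝ, Kerr.IsSubextremal M a ∧ ∀ ε : ENNReal, 0 < ε → ∀ τ₁ : ℝ, ∃ τ : ℝ, τ₁ ≤ τ ∧ (let B := boostedKerrBackground (mo i).1 (mo i).2 M a; ∃ Ψ : B.domain → 𝓢.carrier, ContMDiff 𝓘(ℝ, E4) (𝓡 4) ∞ Ψ ∧ Topology.IsOpenEmbedding ({x : B.domain | |t i x.1 - τ| < 1 ∧ d i x.1 < σ i (t i x.1) + |a| + 6}.restrict Ψ) ∧ (∀ x : B.domain, |t i x.1 -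 τ| < 1 → σ i (t i x.1) + 1 ≤ d i x.1 → d i x.1 < σ i (t i x.1) + 4 → ∃ hx : x.1 + dr i (t i x.1) ∈ (U : Set E4), Ψ x = Φ ⟨_, hx⟩) ∧ 𝓢.truncDeviationCk B Ψ 2 (σ i τ + 5) τ ≤ ε)); ∀ (X : Type) [TopologicalSpace X] [ChartedSpace E3 X] [IsManifold (𝓡 3) ∞ X] [T2Space X] [SecondCountableTopology X] [ConnectedSpace X], InitialDataSet.IsTameChristodoulouGeneric (admissibleVacuumData X) (fun D ↦ ∀ 𝒟 : VacuumCauchyDevelopment D, 𝒟.IsMaximal → ∃ (N : ℕ) (mo : Fin N → lorentzGroup × E4) (σ : Fin N → ℝ → ℝ) (dr : Fin N → ℝ → E4) (T : ℝ) (U : Opens E4) (Φ : U → 𝒟.carrier), Island 𝒟.toSpacetime (range 𝒟.embed) N mo σ dr T U Φ) 1 := by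
  sorry

/-- **ISLAND KINEMATICS — UNIQUENESS OF THE TANGENT CONE AT `i⁺`** (deterministic; the route
header's `IslandKinematics`, card K1 proper: "finite impulse `∫ dt/t²` ⇒ asymptotic velocities +
sublinear drifts"). For EVERY admissible datum `D`, every MGHD `𝒟` and every island data
`(N, (Λᵢ,cᵢ), σᵢ, dᵢ, T, U, Φ)` on `𝒟` there are cone data `(N', (Λ'ᵢ,c'ᵢ), σ'ᵢ, d'ᵢ, T', U', Φ')`
on `𝒟` in the sense of the crux (the route's `Cone` predicate verbatim: sublinear
`(|σ'ᵢ| + ‖d'ᵢ‖)/s → 0`, interior scale-invariant flatness off the STRAIGHT rays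
`{d'ᵢ(x) ≥ δτ}`, and all other clauses). Content: every island world-line has an asymptotic
velocity, equal to its basin frame's, with sublinear residual drift (the GR analogue of
Chazy 1922 / Marchal–Saari 1976 for the Newtonian `N`-body problem: `qᵢ = Aᵢ t + O(t^(2/3))` unless
superhyperbolic — excluded here by causality), after which flatness off the fattened tubes is
flatness off the straight rays for late `τ` (bookkeeping), the other clauses being carried over.
Why it might fail: no equations-of-motion theorem for strong-field bodies in GR bounds the tidal
impulse between islands whose separation grows at an unquantified rate (`σᵢ → ∞` only); a
Chazy-type eternally wandering island, or two islands with a common velocity and drifts `~ t^(2/3)`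
whose fattened tubes the re-chosen sublinear radii cannot separate, would break (a) resp. the
disjointness bookkeeping. Sources: Chazy1922 (Ann. Sci. ÉNS 39, 29–130; doi:10.24033/asens.739),
MarchalSaari1976 (J. Differential Equations 20, 150–186; doi:10.1016/0022-0396(76)90101-7),
arXiv:1601.01871 (soliton resolution along rays), doi:10.2307/2006981 and Allard1972 (uniqueness of
tangent cones, the GMT side of the route's dictionary), DafermosLuk2017. Size: L–XL. -/
theorem stub_coneKinematics : open Literature.Geometry.Lorentzian in open scoped ContDiff in let Island := fun (𝓢 : Spacetime.{0} 4) (S : Set 𝓢.carrier) (N : ℕ) (mo : Fin N → lorentzGroup × E4) (σ : Fin N → ℝ → ℝ) (dr : Fin N → ℝ → E4) (T : ℝ) (U : Opens E4) (Φ : U → 𝓢.carrier) => let t := fun i (x : E4) => poincareInv (mo i).1 (mo i).2 x 0; let d := fun i (x : E4) => E4.spatialNorm (poincareInv (mo i).1 (mo i).2 x); let tube := fun i (w : ℝ) => (fun x ↦ x + dr i (t i x)) '' {x : E4 | d i x ≤ σ i (t i x) + w} ∩ {y | T < y 0}; let F := Minkowski.backgroundOn U; (∀ i, Summit.FinalStateConjecture.IsOrthochronous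 (mo i).1 ∧ Continuous (σ i) ∧ Continuous (dr i) ∧ Tendsto (fun s : ℝ ↦ σ i s / s) atTop (𝓝 0) ∧ Tendsto (σ i) atTop atTop) ∧ (∀ i j, i ≠ j → Disjoint (tube i 5) (tube j 5)) ∧ {y : E4 | T < y 0} \ (⋃ i, tube i 0) ⊆ (U : Set E4) ∧ 𝓢.IsLateChart F (𝓢.metric.causalFuture 𝓢.timeOrientation S) T Φ ∧ (∀ x : U, 𝓢.timeOrientation.IsFutureDirected (mfderiv 𝓘(ℝ, E4) (𝓡 4) Φ x (EuclideanSpace.single 0 1))) ∧ (∀ δ : ℝ, 0 < δ → Tendsto (fun τ : ℝ ↦ weightedCkSeminorm ({x : E4 | x 0 = τ ∧ E4.spatialNorm x ≤ (1 - δ) * τ} \ ⋃ i, tube i (δ * τ)) 2 0 (𝓢.deviationExtend F Φ)) atTop (𝓝 0)) ∧ Tendsto (fun τ : ℝ ↦ 𝓢.deviationCk F Φ 2 τ) atTop (𝓝 0) ∧ (∀ i, ∃ M a : ℝ, Kerr.IsSubextremal M a ∧ ∀ ε : ENNReal, 0 < ε → ∀ τ₁ : ℝ, ∃ τ : ℝ,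 τ₁ ≤ τ ∧ (let B := boostedKerrBackground (mo i).1 (mo i).2 M a; ∃ Ψ : B.domain → 𝓢.carrier, ContMDiff 𝓘(ℝ, E4) (𝓡 4) ∞ Ψ ∧ Topology.IsOpenEmbedding ({x : B.domain | |t i x.1 - τ| < 1 ∧ d i x.1 < σ i (t i x.1) + |a| + 6}.restrict Ψ) ∧ (∀ x : B.domain, |t i x.1 - τ| < 1 → σ i (t i x.1) + 1 ≤ d i x.1 → d i x.1 < σ i (t i x.1) + 4 → ∃ hx : x.1 + dr i (t i x.1) ∈ (U : Set E4), Ψ x = Φ ⟨_, hx⟩) ∧ 𝓢.truncDeviationCk B Ψ 2 (σ i τ + 5) τ ≤ ε)); let Cone := fun (𝓢 : Spacetime.{0} 4) (S : Set 𝓢.carrier) (N : ℕ) (mo : Fin N → lorentzGroup × E4) (σ : Fin N → ℝ → ℝ) (dr : Fin N → ℝ → E4) (T : ℝ) (U : Opens E4) (Φ : U → 𝓢.carrier) => let t := fun i (x : E4) => poincareInv (mo i).1 (mo i).2 x 0; let d := fun i (x : E4) => E4.spatialNorm (poincareInv (mo i).1 (mo i).2 x); let tube := fun i (w : ℝ)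 => (fun x ↦ x + dr i (t i x)) '' {x : E4 | d i x ≤ σ i (t i x) + w} ∩ {y | T < y 0}; let F := Minkowski.backgroundOn U; (∀ i, Summit.FinalStateConjecture.IsOrthochronous (mo i).1 ∧ Continuous (σ i) ∧ Continuous (dr i) ∧ Tendsto (fun s : ℝ ↦ (|σ i s| + ‖dr i s‖) / s) atTop (𝓝 0) ∧ Tendsto (σ i) atTop atTop) ∧ (∀ i j, i ≠ j → Disjoint (tube i 5) (tube j 5)) ∧ {y : E4 | T < y 0} \ (⋃ i, tube i 0) ⊆ (U : Set E4) ∧ 𝓢.IsLateChart F (𝓢.metric.causalFuture 𝓢.timeOrientation S) T Φ ∧ (∀ x : U, 𝓢.timeOrientation.IsFutureDirected (mfderiv 𝓘(ℝ, E4) (𝓡 4) Φ x (EuclideanSpace.single 0 1))) ∧ (∀ δ : ℝ, 0 < δ → Tendsto (fun τ : ℝ ↦ weightedCkSeminorm {x : E4 | x 0 = τ ∧ E4.spatialNorm x ≤ (1 - δ) * τ ∧ ∀ i, δ * τ ≤ d i x} 2 0 (𝓢.deviationExtend F Φ)) atTop (𝓝 0)) ∧ Tendsto (fun τ : ℝ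 ↦ 𝓢.deviationCk F Φ 2 τ) atTop (𝓝 0) ∧ (∀ i, ∃ M a : ℝ, Kerr.IsSubextremal M a ∧ ∀ ε : ENNReal, 0 < ε → ∀ τ₁ : ℝ, ∃ τ : ℝ, τ₁ ≤ τ ∧ (let B := boostedKerrBackground (mo i).1 (mo i).2 M a; ∃ Ψ : B.domain → 𝓢.carrier, ContMDiff 𝓘(ℝ, E4) (𝓡 4) ∞ Ψ ∧ Topology.IsOpenEmbedding ({x : B.domain | |t i x.1 - τ| < 1 ∧ d i x.1 < σ i (t i x.1) + |a| + 6}.restrict Ψ) ∧ (∀ x : B.domain, |t i x.1 - τ| < 1 → σ i (t i x.1) + 1 ≤ d i x.1 → d i x.1 < σ i (t i x.1) + 4 → ∃ hx : x.1 + dr i (t i x.1) ∈ (U : Set E4), Ψ x = Φ ⟨_, hx⟩) ∧ 𝓢.truncDeviationCk B Ψ 2 (σ i τ + 5) τ ≤ ε)); ∀ (X : Type) [TopologicalSpace X] [ChartedSpace E3 X] [IsManifold (𝓡 3) ∞ X] [T2Space X] [SecondCountableTopology X] [ConnectedSpace X] (D : InitialDataSet (𝓡 3) X), D ∈ admissibleVacuumData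 X → ∀ 𝒟 : VacuumCauchyDevelopment D, 𝒟.IsMaximal → ∀ (N : ℕ) (mo : Fin N → lorentzGroup × E4) (σ : Fin N → ℝ → ℝ) (dr : Fin N → ℝ → E4) (T : ℝ) (U : Opens E4) (Φ : U → 𝒟.carrier), Island 𝒟.toSpacetime (range 𝒟.embed) N mo σ dr T U Φ → ∃ (N' : ℕ) (mo' : Fin N' → lorentzGroup × E4) (σ' : Fin N' → ℝ → ℝ) (dr' : Fin N' → ℝ → E4) (T' : ℝ) (U' : Opens E4) (Φ' : U' → 𝒟.carrier), Cone 𝒟.toSpacetime (range 𝒟.embed) N' mo' σ' dr' T' U' Φ' := by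
  sorry

/-! ## Composition: the crux BY NAME from the three stubs (real proof, no `sorry`) -/

/-- **`FiniteKerrParticleCone` from the three stubs.** Tame Christodoulou genericity is monotone
under pointwise implication on the admissible class (`IsTameChristodoulouGeneric.mono`: the same end
and the same witness family serve the smaller exceptional set); at an admissible datum whose every
MGHD carries island data, `stub_mghdExists` gives the MGHD and `stub_coneKinematics` the cone data,
MGHD by MGHD. -/
theorem FiniteKerrParticleCone_of :
    Sig.stub_mghdExists → Sig.stub_islands → Sig.stub_coneKinematics →
      Summit.FinalStateConjecture.FinalStateConjecture.Theses.TangentConeAtIPlus.FiniteKerrParticleCone := by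
  intro hM hI hK X _ _ _ _ _ _
  refine InitialDataSet.IsTameChristodoulouGeneric.mono (hI X) ?_
  intro D hD hisl
  refine ⟨hM X D hD, fun 𝒟 h𝒟 ↦ ?_⟩
  obtain ⟨N, mo, σ, dr, T, U, Φ, h⟩ := hisl 𝒟 h𝒟
  exact hK X D hD 𝒟 h𝒟 N mo σ dr T U Φ h

/-- The crux by name, closed modulo the three registered stubs: a kernel check that each `Sig.stub_*`
is definitionally the statement of the corresponding `stub_*` (an `example`, so that
`FiniteKerrParticleCone_of` is the file's only theorem concluding the crux). -/
example : Summit.FinalStateConjecture.FinalStateConjecture.Theses.TangentConeAtIPlus.FiniteKerrParticleCone :=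
  FiniteKerrParticleCone_of stub_mghdExists stub_islands stub_coneKinematics

/-- The legend agrees with the registered stubs: each `Sig.stub_*` is (definitionally) the statement of
`stub_*` — the three stubs by name inhabit the three hypotheses of `FiniteKerrParticleCone_of`. -/
theorem stubs_agree : Sig.stub_mghdExists ∧ Sig.stub_islands ∧ Sig.stub_coneKinematics :=
  ⟨stub_mghdExists, stub_islands, stub_coneKinematics⟩

end Summit.FinalStateConjecture.FinalStateConjecture.Cruxes.FiniteKerrParticleCone.Birth

end
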